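import Summits.CriticalPhenomena.PercolationContinuityZ3.Theorems.FK.SelfDualPointNonPercolation
import Summits.CriticalPhenomena.PercolationContinuityZ3.Theorems.FK.UniquenessOfEqualTheta
import HarnessLib

/-!
# Zhang's argument on `ℤ²`, VIII: the dichotomy at the self-dual point
# (Grimmett 2006, §6.2 Thm. (6.17) with §6.4: `θ¹(p_sd(q), q) > 0 ⇒ p_c(q) = p_sd(q)`)

Claimed R42 (8)(c) in the cell INBOX at 2026-08-27T23:02:25Z by fkp-10a gen 351 (NEW CLAIM #3 of the gen), addressed to coordinator fk-4 g261 (seated 19:52Z 2026-08-27; R142 l.8183, R143 l.8196); lineage row FO-10a-g351d (self-suggested), package g351-dichotomy, label DI-A.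
Support file of the `fk-continuity` cell (lineage fkp-10a, `--supports stmt-CriticalPhenomena-4575`); builds on
p205010 (kernel theorem, internal audit signed; external expert review pending).  No definitions, no named facts,
no sorries; standard axioms.  `d = 2`, `q ≥ 1`.

By Thm. (6.17)(a) (`thetaFree_selfDual_eq_zero`) the FREE measure does not percolate at `p_sd(q) = √q/(1+√q)`; the
WIRED one may (and does for large `q`, Thm. (6.35), the way Grimmett proves `p_c(q) = p_sd(q)` for `q ≥ 25.72`:
"θ¹(p,q) > 0 when p = √q/(1+√q). By Theorem 6.17(a), this implies parts (a) and (b)", p. 144).  This file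
records the resulting DICHOTOMY at the self-dual point:

* `rcCriticalProb_eq_selfDual_of_thetaWired_selfDual_pos` — **if `θ¹(p_sd(q), q) > 0` then `p_c(q) = p_sd(q)`**
  (a discontinuous transition at `p_sd` pins the critical point);
* `rcLimit_selfDual_eq_iff_thetaWired_selfDual_eq_zero` — `φ⁰_{p_sd,q} = φ¹_{p_sd,q} ↔ θ¹(p_sd(q), q) = 0`;
* `rcLimit_false_ne_rcLimit_true_selfDual_of_thetaWired_pos`, `thetaWired_selfDual_pos_of_ne`;
* `rcCriticalProb_eq_selfDual_or_forall_rcLimit_eq` — **either `p_c(q) = p_sd(q)`, or the random-cluster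
  measure on `ℤ²` is unique (`φ⁰_{p,q} = φ¹_{p,q}`) at EVERY `p ∈ [0,1]`**;
* `forall_rcLimit_eq_of_selfDual_lt_rcCriticalProb` — contrapositive: if `p_sd(q) < p_c(q)` then `φ⁰ = φ¹`
  everywhere (in particular at `p_sd(q)` and at `p_c(q)`).

What is NOT here: which branch holds (`p_c(q) = p_sd(q)` for all `q ≥ 1`, Beffara–Duminil-Copin 2012; first
order iff `q > 4`); nothing about `d ≥ 3`.

## References

* G. Grimmett, *The Random-Cluster Model*, Springer 2006, §6.2 Thm. (6.17); §6.4 Thm. (6.35) and its proof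
  (p. 144, "By Theorem 6.17(a), this implies parts (a) and (b)"); Thm. (5.16). [Grimmett2006]
* G. Grimmett, *Percolation*, 2nd ed., Springer 1999, §11.3. [GrimmettPercolation1999]
-/

noncomputable section

open scoped Classical Topology
open MeasureTheory Filter Set

namespace Summit.CriticalPhenomena.PercolationContinuityZ3.Theorems.FK

open Literature.Probability.Percolation Literature.Probability.LatticeModels
  Literature.Barriers.CriticalPhenomena

variable {q : ℝ}

/-- `√q/(1+√q) ∈ [0,1]` for every real `q` (`√q ≥ 0`). [folklore] -/
theorem selfDual_mem_Icc (q : ℝ) : Real.sqrt q / (1 + Real.sqrt q) ∈ Set.Icc (0 : ℝ) 1 := by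
  have hs : 0 ≤ Real.sqrt q := Real.sqrt_nonneg q
  exact ⟨by positivity, by rw [div_le_one (by positivity)]; linarith⟩

/-- **A percolating wired measure at the self-dual point pins the critical point**: if `θ¹(p_sd(q), q) > 0`
(`q ≥ 1`) then `p_c(q) = p_sd(q) = √q/(1+√q)` on `ℤ²` (`p_c ≤ p_sd` from `θ¹ > 0`, `p_c ≥ p_sd` by Thm. (6.17)(a)).
This is the route of Grimmett's proof of `p_c(q) = p_sd(q)` for large `q` (Thm. (6.35)).
[cite: Grimmett2006, §6.4 proof of Thm. (6.35) (p. 144) with §6.2 Thm. (6.17)(a)] -/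
theorem rcCriticalProb_eq_selfDual_of_thetaWired_selfDual_pos (hq : 1 ≤ q)
    (hpos : 0 < thetaWired 2 (Real.sqrt q / (1 + Real.sqrt q)) q) :
    rcCriticalProb 2 q = Real.sqrt q / (1 + Real.sqrt q) :=
  le_antisymm (rcCriticalProb_le_of_thetaWired_pos hq (selfDual_mem_Icc q) hpos)
    (selfDual_le_rcCriticalProb hq)

/-- **Uniqueness at the self-dual point ⟺ the wired measure does not percolate there**:
`φ⁰_{p_sd,q} = φ¹_{p_sd,q} ↔ θ¹(p_sd(q), q) = 0` (`q ≥ 1`; Thm. (5.16)(c) `φ⁰ = φ¹ ↔ θ⁰ = θ¹`, and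
`θ⁰(p_sd(q), q) = 0` by Thm. (6.17)(a)). [cite: Grimmett2006, §6.2 Thm. (6.17)(a) with Thm. (5.16)(c)] -/
theorem rcLimit_selfDual_eq_iff_thetaWired_selfDual_eq_zero (hq : 1 ≤ q) :
    rcLimit 2 false (Real.sqrt q / (1 + Real.sqrt q)) q = rcLimit 2 true (Real.sqrt q / (1 + Real.sqrt q)) q ↔
      thetaWired 2 (Real.sqrt q / (1 + Real.sqrt q)) q = 0 := by
  rw [rcLimit_false_eq_rcLimit_true_iff_thetaFree_eq_thetaWired (selfDual_mem_Icc q) hq,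
    thetaFree_selfDual_eq_zero hq]
  exact ⟨fun h => h.symm, fun h => h.symm⟩

/-- If the wired measure percolates at `p_sd(q)` then the free and wired measures differ there (a first-order
transition at the self-dual point). [cite: Grimmett2006, §6.2 Thm. (6.17)(a) with Thm. (5.16)(c); §6.4 Thm. (6.35)] -/
theorem rcLimit_false_ne_rcLimit_true_selfDual_of_thetaWired_pos (hq : 1 ≤ q)
    (hpos : 0 < thetaWired 2 (Real.sqrt q / (1 + Real.sqrt q)) q) :
    rcLimit 2 false (Real.sqrt q / (1 + Real.sqrt q)) q ≠ rcLimit 2 true (Real.sqrt q / (1 + Real.sqrt q)) q :=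
  fun h => hpos.ne' ((rcLimit_selfDual_eq_iff_thetaWired_selfDual_eq_zero hq).1 h)

/-- Conversely, phase coexistence at `p_sd(q)` means the wired measure percolates there: `φ⁰_{p_sd} ≠ φ¹_{p_sd}`
implies `θ¹(p_sd(q), q) > 0`. [cite: Grimmett2006, §6.2 Thm. (6.17)(a) with Thm. (5.16)(c)] -/
theorem thetaWired_selfDual_pos_of_ne (hq : 1 ≤ q)
    (hne : rcLimit 2 false (Real.sqrt q / (1 + Real.sqrt q)) q ≠
      rcLimit 2 true (Real.sqrt q / (1 + Real.sqrt q)) q) :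
    0 < thetaWired 2 (Real.sqrt q / (1 + Real.sqrt q)) q :=
  lt_of_le_of_ne (thetaWired_nonneg 2 _ q)
    (fun h => hne ((rcLimit_selfDual_eq_iff_thetaWired_selfDual_eq_zero hq).2 h.symm))

/-- **The dichotomy at the self-dual point**: for the random-cluster model on `ℤ²` with `q ≥ 1`, EITHER
`p_c(q) = p_sd(q)`, OR the free and wired measures coincide at every `p ∈ [0,1]` (uniqueness of the
random-cluster measure at all parameter values, including `p_sd(q)`).  Indeed if `φ⁰_{p_sd} ≠ φ¹_{p_sd}` then
`θ¹(p_sd) > 0` and the first branch holds; otherwise Thm. (6.17)(b) covers `p ≠ p_sd`.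
[cite: Grimmett2006, §6.2 Thm. (6.17) with §6.4 Thm. (6.35)] -/
theorem rcCriticalProb_eq_selfDual_or_forall_rcLimit_eq (hq : 1 ≤ q) :
    rcCriticalProb 2 q = Real.sqrt q / (1 + Real.sqrt q) ∨
      ∀ p ∈ Set.Icc (0 : ℝ) 1, rcLimit 2 false p q = rcLimit 2 true p q := by
  by_cases h : rcLimit 2 false (Real.sqrt q / (1 + Real.sqrt q)) q =
      rcLimit 2 true (Real.sqrt q / (1 + Real.sqrt q)) q
  · refine Or.inr fun p hp => ?_
    by_cases hps : p = Real.sqrt q / (1 + Real.sqrt q)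
    · rw [hps]; exact h
    · exact rcLimit_false_eq_rcLimit_true_of_ne_selfDual' hp hq hps
  · exact Or.inl (rcCriticalProb_eq_selfDual_of_thetaWired_selfDual_pos hq (thetaWired_selfDual_pos_of_ne hq h))

/-- **If `p_sd(q) < p_c(q)` then the random-cluster measure on `ℤ²` is unique at every `p ∈ [0,1]`**
(contrapositive form of the dichotomy; `q ≥ 1`). [cite: Grimmett2006, §6.2 Thm. (6.17)] -/
theorem forall_rcLimit_eq_of_selfDual_lt_rcCriticalProb (hq : 1 ≤ q)
    (hlt : Real.sqrt q / (1 + Real.sqrt q) < rcCriticalProb 2 q) :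
    ∀ p ∈ Set.Icc (0 : ℝ) 1, rcLimit 2 false p q = rcLimit 2 true p q := by
  rcases rcCriticalProb_eq_selfDual_or_forall_rcLimit_eq hq with h | h
  · exact absurd h hlt.ne'
  · exact h

end Summit.CriticalPhenomena.PercolationContinuityZ3.Theorems.FK

end
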